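import Summits.ResolutionOfSingularities.ResolutionOfSingularities.Theorems.PurelyInseparableDim4ParamCertEight
import HarnessLib

/-!
# [OURS · res-dim4-pi · F4-C-loc] PARAMETRIC CERTIFICATES, format v9 (part 1: the TREE FORMAT): the v6 chart trees plus a
  NODE-LEVEL TORUS step — the letter is scaled away in the middle of B's reply, before the remaining coordinates are pinned

Cell `res-dim4-pi` (D-0157 DOOR 2, wave 2), seat `res-dim4-p-6` g4; sequel of `…ParamCertSix` (trees), `…LocalGameTorus`
(torus invariance) and `…ParamCertEight` (rows).  Three census roots (2802/2803/2836, `x₁x₂x₃(x₁x₂x₃ + c x₀³)`-shapes) give B a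
two-dimensional reply family at the first move; with one fibre letter the second coordinate can only be introduced after the
first letter has been scaled away — INSIDE the chart tree.  `PNode9` = `PNode6`'s constructors + `torusN w N sub`: the current
data `G` (one letter, exponent affine: `a + w·e = N`) is replaced by its letter-free representative `normT (setT0 G)` with the
same free coordinates; every completion `b` of B's reply against `G` is the completion `ν·b` against the representative
(`ν = β^{−w}`), so A's wins transport by `Torus.rWins_C_mul_scale_iff` (soundness: part 2, `…ParamCertNineSound`).  The node
checker reads certified TERM LISTS (`rows`, `memRowT`) rather than typed rows, so the v9 row file can feed it projected v8/v7
rows and external rows alike.  Checkers `pnode9B` / `pforest9B` / `proots9B` / `pquads9B`, heights, membership lemmas.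

[OURS · counted 0 · certificate format; AI kernel work, weaker than expert review.]  NOTHING here is a statement about
resolution of singularities; resolution in dimension `≥ 4` / characteristic `p > 0` is NOT proved by anything in this
file.  bears_on: LADDER-RESOLUTION:D157-DOOR2 (res-dim4-pi · F4-C-loc all fields · trees v9).  Host item (DR-157-C):
`stmt-ResolutionOfSingularities-16155`, helper.
-/

set_option linter.dupNamespace false -- mandated namespace of this single-conjunct summit

noncomputable section

open MvPolynomial Finset
open scoped BigOperators

namespace Summit.ResolutionOfSingularities.ResolutionOfSingularities.Theorems.PIDim4

namespace LoopCLocal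

open Literature.AlgebraicGeometry.Resolution
open Literature.AlgebraicGeometry.Resolution.CentreBlowup
open StepKit ParamLift

section Format

variable {k : Type} [Field k] [DecidableEq k]

/-! ## §1 The v9 tree format -/

/-- a v9 chart-tree node: the v6 nodes plus `torusN`, read against CURRENT chart data `G`, free coordinates `U`, and the
certified term lists `rows`. OURS. [folklore] -/
inductive PNode9 (k : Type) : Type
  /-- no equimultiple point remains: witness `γ` (collected coefficient) -/
  | dead (γ : Fin 4 → ℕ)
  /-- all coordinates pinned: the child `clean4 q G` is `0` or a later row -/
  | child
  /-- `bᵢ = 0` continues in `zero`; `bᵢ ≠ 0` becomes the letter and continues in `letter` (`G` t-free) -/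
  | free (i : Fin 4) (zero letter : PNode9 k)
  /-- certified root set of the constraint on `bᵢ` (sources of `γ`, letter powers `M − tr·deg`): zero branch (iff
  `d₀ > 0`), a subtree per monomial root `f ρ·β^{tr}`, a subtree per quadratic factor (rational continuation) -/
  | roots (γ : Fin 4 → ℕ) (i : Fin 4) (tr M : ℕ) (A : k) (d₀ : ℕ) (zero : PNode9 k)
      (rts : List ((k × ℕ) × PNode9 k)) (qds : List ((k × k × ℕ) × PNode9 k))
  /-- tie `bᵢ = f ρ·b_{i'}^d`: `b_{i'} = 0` continues in `zero`, `b_{i'} ≠ 0` becomes the letter and continues in `letter` -/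
  | pair (γ : Fin 4 → ℕ) (i i' : Fin 4) (ρ : k) (d : ℕ) (zero letter : PNode9 k)
  /-- binomial relation: some `bᵢ = 0`, `i ∈ zs`; subtrees per coordinate -/
  | rel (γ γ' : Fin 4 → ℕ) (zs : Finset (Fin 4)) (nu : Fin 4 → ℕ) (κ : k) (subs : List (Fin 4 × PNode9 k))
  /-- product forcing: some listed coordinate vanishes; subtrees per coordinate -/
  | split (γ : Fin 4 → ℕ) (subs : List (Fin 4 × PNode9 k))
  /-- NODE-LEVEL TORUS: the current data's letter exponent is affine (`a + w·e = N`); continue on the letter-free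
  representative `normT (setT0 G)` with the same free coordinates (B's remaining replies range over the same set up to the torus) -/
  | torusN (w : Fin 4 → ℤ) (N : ℤ) (sub : PNode9 k)

/-- `L` presents the same polynomial as one of the certified term lists `rows`. OURS. [folklore] -/
def memRowT (L : Terms 5 k) (rows : List (Terms 5 k)) : Bool := rows.any fun r => StepKit.equivB L r

/-- a child is fine if it is `0` or a certified row. OURS. [folklore] -/
def pchildT (L : Terms 5 k) (rows : List (Terms 5 k)) : Bool := StepKit.equivB L [] || memRowT L rows

mutual
/-- **node checker v9** against current data `G`, free coordinates `U` (v6 semantics; `torusN` scales the letter away). OURS. [folklore] -/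
def pnode9B (q : ℕ) (rows : List (Terms 5 k)) : Terms 5 k → Finset (Fin 4) → PNode9 k → Bool
  | G, U, .dead γ => pwitB q U G γ
  | G, U, .child => decide (U = ∅) && pchildT (clean4 q G) rows
  | G, U, .free i zero letter => decide (i ∈ U) && tfreeB G && pnode9B q rows G (U.erase i) zero &&
      pnode9B q rows (normT (shearL i G)) (U.erase i) letter
  | G, U, .roots γ i tr M A d₀ zero rts qds =>
      prootsMB q U G γ i tr M A d₀ (rts.map Prod.fst) (qds.map Prod.fst) &&
      (decide (d₀ = 0) || pnode9B q rows G (U.erase i) zero) &&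
      proots9B q rows G (U.erase i) i tr rts &&
      (decide (qds = []) || tfreeB G) && pquads9B q rows G (U.erase i) i qds
  | G, U, .pair γ i i' ρ d zero letter => tfreeB G && ppairB q U G γ i i' ρ d &&
      pnode9B q rows G (U.erase i') zero &&
      pnode9B q rows (normT (shearMonoL i ρ d (shearL i' G))) ((U.erase i).erase i') letter
  | G, U, .rel γ γ' zs nu κ subs => prelB q U G γ γ' zs nu κ && decide (zs ⊆ (subs.map Prod.fst).toFinset) &&
      pforest9B q rows G U subs
  | G, U, .split γ subs => psplitB q U G γ (subs.map Prod.fst).toFinset && pforest9B q rows G U subs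
  | G, U, .torusN w N sub =>
      decide (∀ t ∈ G, (t.1 (Fin.last 4) : ℤ) + ∑ i : Fin 4, w i * (t.1 i.castSucc : ℤ) = N) &&
        pnode9B q rows (normT (setT0 G)) U sub
/-- subtree-list checker: each `(i, t)` is checked with `i` removed from the free coordinates. OURS. [folklore] -/
def pforest9B (q : ℕ) (rows : List (Terms 5 k)) : Terms 5 k → Finset (Fin 4) → List (Fin 4 × PNode9 k) → Bool
  | _, _, [] => true
  | G, U, (i, t) :: subs => pnode9B q rows G (U.erase i) t && pforest9B q rows G U subs
/-- monomial-root list checker: the subtree of `ρ` is checked on `normT (shearMonoL i ρ tr G)`. OURS. [folklore] -/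
def proots9B (q : ℕ) (rows : List (Terms 5 k)) :
    Terms 5 k → Finset (Fin 4) → Fin 4 → ℕ → List ((k × ℕ) × PNode9 k) → Bool
  | _, _, _, _, [] => true
  | G, U', i, tr, (ρm, t) :: rts =>
      pnode9B q rows (normT (shearMonoL i ρm.1 tr G)) U' t && proots9B q rows G U' i tr rts
/-- quadratic-factor list checker: the subtree of `T² − c₁T − c₀` is checked on `normT (reduceQ c₁ c₀ (shearL i G))`,
which must be letter-free. OURS. [folklore] -/
def pquads9B (q : ℕ) (rows : List (Terms 5 k)) :
    Terms 5 k → Finset (Fin 4) → Fin 4 → List ((k × k × ℕ) × PNode9 k) → Bool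
  | _, _, _, [] => true
  | G, U', i, (c, t) :: qds => tfreeB (normT (reduceQ c.1 c.2.1 (shearL i G))) &&
      pnode9B q rows (normT (reduceQ c.1 c.2.1 (shearL i G))) U' t && pquads9B q rows G U' i qds
end

/-! ## §2 Heights (the recursion measure of the soundness argument) -/

mutual
/-- the height of a v6 tree. OURS. [folklore] -/
def pheight9 : PNode9 k → ℕ
  | .dead _ => 0
  | .child => 0
  | .free _ zero letter => max (pheight9 zero) (pheight9 letter) + 1
  | .roots _ _ _ _ _ _ zero rts qds => max (pheight9 zero) (max (pheightR9 rts) (pheightQ9 qds)) + 1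
  | .pair _ _ _ _ _ zero letter => max (pheight9 zero) (pheight9 letter) + 1
  | .rel _ _ _ _ _ subs => pheightL9 subs + 1
  | .split _ subs => pheightL9 subs + 1
  | .torusN _ _ sub => pheight9 sub + 1
/-- the maximal height in a subtree list. OURS. [folklore] -/
def pheightL9 : List (Fin 4 × PNode9 k) → ℕ
  | [] => 0
  | (_, t) :: subs => max (pheight9 t) (pheightL9 subs)
/-- the maximal height in a rational-root list. OURS. [folklore] -/
def pheightR9 : List ((k × ℕ) × PNode9 k) → ℕ
  | [] => 0
  | (_, t) :: rts => max (pheight9 t) (pheightR9 rts)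
/-- the maximal height in a quadratic-factor list. OURS. [folklore] -/
def pheightQ9 : List ((k × k × ℕ) × PNode9 k) → ℕ
  | [] => 0
  | (_, t) :: qds => max (pheight9 t) (pheightQ9 qds)
end

omit [Field k] [DecidableEq k] in
/-- a member subtree is lower than the list's maximum. OURS. [folklore] -/
theorem pheight9_le_of_memL : ∀ (subs : List (Fin 4 × PNode9 k)) (i : Fin 4) (t : PNode9 k), (i, t) ∈ subs →
    pheight9 t ≤ pheightL9 subs
  | [], _, _, hm => absurd hm List.not_mem_nil
  | (i₀, t₀) :: subs, i, t, hm => by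
    rw [pheightL9]
    rcases List.mem_cons.mp hm with hh | ht
    · rw [(Prod.mk.inj hh).2]; exact le_max_left _ _
    · exact le_trans (pheight9_le_of_memL subs i t ht) (le_max_right _ _)

omit [Field k] [DecidableEq k] in
/-- a member subtree is lower than the root list's maximum. OURS. [folklore] -/
theorem pheight9_le_of_memR : ∀ (rts : List ((k × ℕ) × PNode9 k)) (ρm : k × ℕ) (t : PNode9 k), (ρm, t) ∈ rts →
    pheight9 t ≤ pheightR9 rts
  | [], _, _, hm => absurd hm List.not_mem_nil
  | (ρ₀, t₀) :: rts, ρm, t, hm => by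
    rw [pheightR9]
    rcases List.mem_cons.mp hm with hh | ht
    · rw [(Prod.mk.inj hh).2]; exact le_max_left _ _
    · exact le_trans (pheight9_le_of_memR rts ρm t ht) (le_max_right _ _)

omit [Field k] [DecidableEq k] in
/-- a member subtree is lower than the quadratic list's maximum. OURS. [folklore] -/
theorem pheight9_le_of_memQ : ∀ (qds : List ((k × k × ℕ) × PNode9 k)) (c : k × k × ℕ) (t : PNode9 k),
    (c, t) ∈ qds → pheight9 t ≤ pheightQ9 qds
  | [], _, _, hm => absurd hm List.not_mem_nil
  | (c₀, t₀) :: qds, c, t, hm => by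
    rw [pheightQ9]
    rcases List.mem_cons.mp hm with hh | ht
    · rw [(Prod.mk.inj hh).2]; exact le_max_left _ _
    · exact le_trans (pheight9_le_of_memQ qds c t ht) (le_max_right _ _)

/-! ## §3 Unpacking the list checkers -/

/-- the subtree filed under a coordinate passes the node check with that coordinate removed. OURS. [folklore] -/
theorem pnode9B_of_mem_forest {q : ℕ} {rows : List (Terms 5 k)} {G : Terms 5 k} :
    ∀ (subs : List (Fin 4 × PNode9 k)) (U : Finset (Fin 4)), pforest9B q rows G U subs = true →
      ∀ (i : Fin 4) (t : PNode9 k), (i, t) ∈ subs → pnode9B q rows G (U.erase i) t = true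
  | [], _, _, _, _, hm => absurd hm List.not_mem_nil
  | (i₀, t₀) :: subs, U, h, i, t, hm => by
    simp only [pforest9B, Bool.and_eq_true] at h
    rcases List.mem_cons.mp hm with hh | ht
    · rw [(Prod.mk.inj hh).1, (Prod.mk.inj hh).2]; exact h.1
    · exact pnode9B_of_mem_forest subs U h.2 i t ht

/-- the subtree filed under a monomial root passes the node check on the sheared data. OURS. [folklore] -/
theorem pnode9B_of_mem_roots {q : ℕ} {rows : List (Terms 5 k)} {G : Terms 5 k} {U' : Finset (Fin 4)} {i : Fin 4}
    {tr : ℕ} : ∀ (rts : List ((k × ℕ) × PNode9 k)), proots9B q rows G U' i tr rts = true →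
      ∀ (ρm : k × ℕ) (t : PNode9 k), (ρm, t) ∈ rts → pnode9B q rows (normT (shearMonoL i ρm.1 tr G)) U' t = true
  | [], _, _, _, hm => absurd hm List.not_mem_nil
  | (ρ₀, t₀) :: rts, h, ρm, t, hm => by
    simp only [proots9B, Bool.and_eq_true] at h
    rcases List.mem_cons.mp hm with hh | ht
    · rw [(Prod.mk.inj hh).1, (Prod.mk.inj hh).2]; exact h.1
    · exact pnode9B_of_mem_roots rts h.2 ρm t ht

/-- the subtree filed under a quadratic factor passes the node check on the reduced data, which is letter-free.
OURS. [folklore] -/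
theorem pnode9B_of_mem_quads {q : ℕ} {rows : List (Terms 5 k)} {G : Terms 5 k} {U' : Finset (Fin 4)} {i : Fin 4} :
    ∀ (qds : List ((k × k × ℕ) × PNode9 k)), pquads9B q rows G U' i qds = true →
      ∀ (c : k × k × ℕ) (t : PNode9 k), (c, t) ∈ qds →
        tfreeB (normT (reduceQ c.1 c.2.1 (shearL i G))) = true ∧
          pnode9B q rows (normT (reduceQ c.1 c.2.1 (shearL i G))) U' t = true
  | [], _, _, _, hm => absurd hm List.not_mem_nil
  | (c₀, t₀) :: qds, h, c, t, hm => by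
    simp only [pquads9B, Bool.and_eq_true] at h
    rcases List.mem_cons.mp hm with hh | ht
    · rw [(Prod.mk.inj hh).1, (Prod.mk.inj hh).2]; exact h.1
    · exact pnode9B_of_mem_quads qds h.2 c t ht

end Format

end LoopCLocal

end Summit.ResolutionOfSingularities.ResolutionOfSingularities.Theorems.PIDim4

end
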